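import Mathlib
import HarnessLib
import Literature.MathematicalPhysics.StatisticalMechanics.LennardJonesClusters
import Literature.MathematicalPhysics.StatisticalMechanics.LennardJonesThermodynamicLimitProofs
import Summits.AtomisticToContinuum.Crystallization.Theorems.ChargedEnergyGap.Negative.BlocksBound
import Summits.AtomisticToContinuum.Crystallization.Theorems.ChargedEnergyGap.Negative.Tolerance
import Summits.AtomisticToContinuum.Crystallization.Theorems.ContactSaturationLadderWindowFilling
import Summits.AtomisticToContinuum.Crystallization.Theorems.ContactSaturationLadderCrossTermFloor
import Summits.AtomisticToContinuum.Crystallization.Theorems.CrystalliteDichotomyCutPasteLaw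

/-!
# ContactSaturationLadder · `LooseTextureRung` (stmt-AtomisticToContinuum-30303) — the TRIAL-STATE CEILING on ground-state windows

Helper (`--supports stmt-AtomisticToContinuum-30303`) for the crux `LooseTextureRung` of the route
`ContactSaturationLadder`, line v6 «DialFreeSieveV6» (skeleton of record e7facec0…): the support CEIL of the
lens-1 node `FarChunkExclusion / OneRadius` (decomp-a2c lens-1 g21, critic row 259 (δ)), which turns the
energetic residual FAR′⁺ `FarGapEvFree 2 6` into the energy-free far-chunk exclusion FCE `FarChunkExclusion 2 6`
(node kernel `farChunkExclusion_of_farGapEvFree_ceiling`).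

**The ceiling** (`gsWindowCeiling`, def-free, stated over tree declarations only): for every `ε > 0` there is a
radius `ρ_ε` such that for all `ρ ≥ ρ_ε`, every Lennard-Jones ground state `y : Fin N → ℝ³` and every centre `p`,

  `Σ_{i : |y_i − p| ≤ ρ} (𝓔ⁱ(y)/2 − e⋆) ≤ ε·#{i : |y_i − p| ≤ ρ} + ε·ρ³`,   `e⋆ = ⨅_Q e(Q)`.

Mechanism — three TREE ingredients:
* cut and paste `Σ_{i∈B} 𝓔ⁱ ≤ 2E(#B) + Σ_{B×Bᶜ} V⁻` (`CrystalliteDichotomyCutPasteLaw.stub_cutPasteLaw`, p768900;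
  [cite: BlancLewin2015, §1.2]);
* the trial-state bound `E(n) ≤ n·(e(Q) + η)` for `n ≥ N₀(Q, η)` at a periodic competitor `Q` with
  `e(Q) < e⋆ + ε/2` — the statement of the tree theorem `ExcessDecayLiouvilleCoarseGrains.stub_trialBound`,
  re-derived INSIDE the proof of `gsWindowCeiling` (a `have`, no new declaration) from its two tree ingredients
  `BlancLewin2015_8_holds` ([cite: BlancLewin2015, Thm 8 / §2.1]) and
  `ChargedEnergyGapNegative.le_energyPerParticle_of_tendsto`, because that module is outside this file's import
  closure; small windows use `E(n) ≤ 0` (`ChargedEnergyGapNegative.groundStateEnergy_nonpos`);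
* the ATTRACTIVE cross-term ceiling `Σ_{i∈B(p,ρ)} Σ_{k∉B(p,ρ)} V⁻(|y_i − y_k|) ≤ D·ρ²` (`crossNeg_le`, `ρ ≥ 9`):
  the core / unit-layer bookkeeping of `ContactSaturationLadderCrossTermFloor.stub_crossTermFloor` (p775283:
  `layer_card`, `core_card`, `sum_inv_cube_le`) run on the attractive part `V⁻ = max(0, −V) ≤ (1/6)r⁻⁶`
  (`neg_le_lennardJones_of_le`) at the ground-state minimal distance (`LennardJonesMinimalDistance_holds`),
  with the per-site tails `site_negTail` / `site_negSkin` (`sum_inv_pow_six_le_two_scale_idx`, `sum_inv_pow_six_le`).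
-/

noncomputable section

namespace Summit.AtomisticToContinuum.Crystallization.Theorems.ContactSaturationLadderWindowCeiling

open scoped BigOperators Classical
open Filter Topology Metric
open Literature.MathematicalPhysics.StatisticalMechanics (lennardJones IsGroundState groundStateEnergy
  PeriodicConfiguration siteEnergy LennardJonesMinimalDistance_holds sum_inv_pow_six_le neg_le_lennardJones_of_le
  BlancLewin2015_8_holds)
open Summit.AtomisticToContinuum.Crystallization.Theorems.ContactSaturationLadderWindowFilling (sum_inv_pow_six_le_two_scale_idx)
open Summit.AtomisticToContinuum.Crystallization.Theorems.ContactSaturationLadderCrossTermFloor (layer_card core_card sum_inv_cube_le)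
open Summit.AtomisticToContinuum.Crystallization.Theorems.ChargedEnergyGapNegative (le_energyPerParticle_of_tendsto
  groundStateEnergy_nonpos)

variable {N : ℕ}

/-! ## §1 Per-site attractive cross tails -/

/-- The attractive part of the pair potential beyond distance `t > 0` is at most `(1/6)·t⁻⁶`. [folklore] -/
theorem negPart_lennardJones_le {s t : ℝ} (ht : 0 < t) (hs : t ≤ s) : max 0 (-lennardJones s) ≤ (1 / 6) * t⁻¹ ^ 6 := by
  have h := neg_le_lennardJones_of_le ht hs
  exact max_le (by positivity) (by linarith)

/-- Per-site attractive cross tail at depth `≥ r ≥ δ` below the window sphere: `Σ_{k∈T} V⁻(d_ik) ≤ (1/6)·250·δ⁻³·r⁻³`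
(the mirror of `ContactSaturationLadderCrossTermFloor.site_tail`). [folklore] -/
theorem site_negTail (y : Fin N → EuclideanSpace ℝ (Fin 3)) {δ : ℝ} (hδ : 0 < δ)
    (hsep : ∀ k l : Fin N, k ≠ l → δ ≤ dist (y k) (y l)) (p : EuclideanSpace ℝ (Fin 3)) (ρ : ℝ)
    (T : Finset (Fin N)) (hT : ∀ k ∈ T, ρ < dist (y k) p) {r : ℝ} (hδr : δ ≤ r) {i : Fin N}
    (hi : dist (y i) p ≤ ρ - r) :
    ∑ k ∈ T, max 0 (-lennardJones (dist (y i) (y k))) ≤ (1 / 6) * (250 * δ⁻¹ ^ 3 * r⁻¹ ^ 3) := by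
  have hfar : ∀ k ∈ T, r ≤ dist (y i) (y k) := by
    intro k hk
    have hkp := hT k hk
    have ht := dist_triangle (y k) (y i) p
    rw [dist_comm (y k) (y i)] at ht
    linarith
  have hrpos : 0 < r := lt_of_lt_of_le hδ hδr
  have hterm : ∀ k ∈ T, max 0 (-lennardJones (dist (y i) (y k))) ≤ (1 / 6) * (dist (y i) (y k))⁻¹ ^ 6 := fun k hk =>
    negPart_lennardJones_le (lt_of_lt_of_le hrpos (hfar k hk)) le_rfl
  have h2 := sum_inv_pow_six_le_two_scale_idx y T (y i) hδ hδr (fun k _ l _ hkl => hsep k l hkl) hfar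
  calc ∑ k ∈ T, max 0 (-lennardJones (dist (y i) (y k))) ≤ ∑ k ∈ T, (1 / 6) * (dist (y i) (y k))⁻¹ ^ 6 :=
        Finset.sum_le_sum hterm
    _ = (1 / 6) * ∑ k ∈ T, (dist (y i) (y k))⁻¹ ^ 6 := by rw [Finset.mul_sum]
    _ ≤ (1 / 6) * (250 * δ⁻¹ ^ 3 * r⁻¹ ^ 3) := mul_le_mul_of_nonneg_left h2 (by norm_num)

/-- Per-site attractive cross tail, crude skin form: `Σ_{k∈T} V⁻(d_ik) ≤ (1/6)·250·δ⁻⁶` for `T ∌ i`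
(the mirror of `ContactSaturationLadderCrossTermFloor.site_skin`). [folklore] -/
theorem site_negSkin (y : Fin N → EuclideanSpace ℝ (Fin 3)) {δ : ℝ} (hδ : 0 < δ)
    (hsep : ∀ k l : Fin N, k ≠ l → δ ≤ dist (y k) (y l)) (T : Finset (Fin N)) {i : Fin N}
    (hTi : ∀ k ∈ T, k ≠ i) :
    ∑ k ∈ T, max 0 (-lennardJones (dist (y i) (y k))) ≤ (1 / 6) * (250 * δ⁻¹ ^ 6) := by
  have hterm : ∀ k ∈ T, max 0 (-lennardJones (dist (y i) (y k))) ≤ (1 / 6) * (dist (y i) (y k))⁻¹ ^ 6 := fun k hk =>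
    negPart_lennardJones_le (lt_of_lt_of_le hδ (hsep i k (hTi k hk).symm)) le_rfl
  have h1 : ∑ k ∈ T, (dist (y i) (y k))⁻¹ ^ 6 ≤ ∑ k ∈ Finset.univ.erase i, (dist (y i) (y k))⁻¹ ^ 6 :=
    Finset.sum_le_sum_of_subset_of_nonneg (fun k hk => Finset.mem_erase.2 ⟨hTi k hk, Finset.mem_univ _⟩)
      (fun _ _ _ => by positivity)
  have h2 := sum_inv_pow_six_le y hδ hsep i
  calc ∑ k ∈ T, max 0 (-lennardJones (dist (y i) (y k))) ≤ ∑ k ∈ T, (1 / 6) * (dist (y i) (y k))⁻¹ ^ 6 :=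
        Finset.sum_le_sum hterm
    _ = (1 / 6) * ∑ k ∈ T, (dist (y i) (y k))⁻¹ ^ 6 := by rw [Finset.mul_sum]
    _ ≤ (1 / 6) * (250 * δ⁻¹ ^ 6) := mul_le_mul_of_nonneg_left (h1.trans h2) (by norm_num)

/-! ## §2 The attractive cross-term ceiling -/

/-- **Attractive cross-term ceiling for ground states** (`ρ ≥ 9`): `∃ D, Σ_{i∈B(p,ρ)} Σ_{k∉B(p,ρ)} V⁻(d_ik) ≤ D·ρ²` —
the core / unit-layer count of `ContactSaturationLadderCrossTermFloor.stub_crossTermFloor` with the per-site tails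
`site_negTail` / `site_negSkin` (it implies that floor, and is what cut-and-paste consumes). [folklore] -/
theorem crossNeg_le : ∃ D : ℝ, ∀ ρ : ℝ, 9 ≤ ρ → ∀ (N : ℕ) (y : Fin N → EuclideanSpace ℝ (Fin 3)),
    IsGroundState lennardJones y → ∀ p : EuclideanSpace ℝ (Fin 3),
      ∑ i ∈ (Finset.univ.filter fun i : Fin N => dist (y i) p ≤ ρ),
        ∑ k ∈ (Finset.univ.filter fun i : Fin N => dist (y i) p ≤ ρ)ᶜ, max 0 (-lennardJones (dist (y i) (y k))) ≤ D * ρ ^ 2 := by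
  obtain ⟨δ₀, hδ₀, hsep₀⟩ := LennardJonesMinimalDistance_holds
  set δ : ℝ := min δ₀ 1 with hδdef
  have hδ : 0 < δ := lt_min hδ₀ one_pos
  have hδ1 : δ ≤ 1 := min_le_right _ _
  have hδle : δ ≤ δ₀ := min_le_left _ _
  set A : ℝ := (1 / 6) * (250 * δ⁻¹ ^ 3) with hA
  have hA0 : 0 < A := by rw [hA]; positivity
  set D : ℝ := 64 * A * δ⁻¹ ^ 3 + 60 * δ⁻¹ ^ 3 * (A * δ⁻¹ ^ 3 + 2 * A) with hD
  refine ⟨D, ?_⟩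
  intro ρ hρ9 N y hy p
  have hρ0 : 0 < ρ := by linarith
  have hsep : ∀ k l : Fin N, k ≠ l → δ ≤ dist (y k) (y l) := fun k l hkl => hδle.trans (hsep₀ N y hy k l hkl)
  have hyinj : Function.Injective y := hy.1
  set W := Finset.univ.filter (fun i : Fin N => dist (y i) p ≤ ρ) with hW
  set T := Wᶜ with hT
  have hmW : ∀ i : Fin N, i ∈ W ↔ dist (y i) p ≤ ρ := fun i => by rw [hW]; simp
  have hmT : ∀ k : Fin N, k ∈ T → ρ < dist (y k) p := fun k hk => by
    rw [hT, Finset.mem_compl, hmW] at hk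
    exact not_le.1 hk
  have hTi : ∀ i ∈ W, ∀ k ∈ T, k ≠ i := fun i hi k hk h => by
    rw [hT, Finset.mem_compl] at hk
    exact hk (h ▸ hi)
  -- split the window into the core `|y_i − p| ≤ ρ/2` and the outer half
  rw [← Finset.sum_filter_add_sum_filter_not W (fun i : Fin N => dist (y i) p ≤ ρ / 2)]
  set K := W.filter (fun i : Fin N => dist (y i) p ≤ ρ / 2) with hK
  set O := W.filter (fun i : Fin N => ¬ dist (y i) p ≤ ρ / 2) with hO
  ------------------------------------------------------------------ the core
  have hcore_site : ∀ i ∈ K, ∑ k ∈ T, max 0 (-lennardJones (dist (y i) (y k))) ≤ A * (ρ / 2)⁻¹ ^ 3 := by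
    intro i hi
    have hi' : dist (y i) p ≤ ρ / 2 := (Finset.mem_filter.1 hi).2
    have h := site_negTail y hδ hsep p ρ T hmT (r := ρ / 2) (by linarith) (i := i) (by linarith)
    have hA' : (1 / 6) * (250 * δ⁻¹ ^ 3 * (ρ / 2)⁻¹ ^ 3) = A * (ρ / 2)⁻¹ ^ 3 := by rw [hA]; ring
    linarith
  have hKcard : (K.card : ℝ) ≤ 8 * ρ ^ 3 * δ⁻¹ ^ 3 := by
    have hKW : K = Finset.univ.filter (fun i : Fin N => dist (y i) p ≤ ρ / 2) := by
      ext i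
      rw [hK, Finset.mem_filter, hmW]
      simp only [Finset.mem_filter, Finset.mem_univ, true_and]
      constructor
      · exact fun h => h.2
      · exact fun h => ⟨by linarith, h⟩
    rw [hKW]
    have h := core_card y hyinj hδ hsep p (R := ρ / 2) (by linarith)
    have h1 : 2 * (ρ / 2) / δ + 1 ≤ 2 * ρ / δ := by
      rw [show 2 * (ρ / 2) / δ = ρ / δ by ring, show 2 * ρ / δ = 2 * (ρ / δ) by ring]
      have : 1 ≤ ρ / δ := by rw [le_div_iff₀ hδ]; linarith
      linarith
    have h0 : 0 ≤ 2 * (ρ / 2) / δ + 1 := by positivity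
    calc ((Finset.univ.filter fun i : Fin N => dist (y i) p ≤ ρ / 2).card : ℝ) ≤ (2 * (ρ / 2) / δ + 1) ^ 3 := h
      _ ≤ (2 * ρ / δ) ^ 3 := pow_le_pow_left₀ h0 h1 3
      _ = 8 * ρ ^ 3 * δ⁻¹ ^ 3 := by ring
  have hcore : ∑ i ∈ K, ∑ k ∈ T, max 0 (-lennardJones (dist (y i) (y k))) ≤ 64 * A * δ⁻¹ ^ 3 := by
    have h1 := Finset.sum_le_sum hcore_site
    rw [Finset.sum_const, nsmul_eq_mul] at h1
    have h2 : (ρ / 2)⁻¹ ^ 3 = 8 * ρ⁻¹ ^ 3 := by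
      rw [inv_div, div_eq_mul_inv, mul_pow]
      norm_num
    have h3 : ρ ^ 3 * ρ⁻¹ ^ 3 = 1 := by rw [← mul_pow, mul_inv_cancel₀ hρ0.ne', one_pow]
    have h4 : (K.card : ℝ) * (A * (ρ / 2)⁻¹ ^ 3) ≤ 64 * A * δ⁻¹ ^ 3 := by
      rw [h2]
      calc (K.card : ℝ) * (A * (8 * ρ⁻¹ ^ 3)) ≤ (8 * ρ ^ 3 * δ⁻¹ ^ 3) * (A * (8 * ρ⁻¹ ^ 3)) :=
            mul_le_mul_of_nonneg_right hKcard (by positivity)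
        _ = 64 * A * δ⁻¹ ^ 3 * (ρ ^ 3 * ρ⁻¹ ^ 3) := by ring
        _ = 64 * A * δ⁻¹ ^ 3 := by rw [h3, mul_one]
    linarith
  ------------------------------------------------------------------ the outer half, by unit layers
  set dep : Fin N → ℕ := fun i => ⌊ρ - dist (y i) p⌋₊ with hdep
  set M' : ℕ := ⌊ρ / 2⌋₊ with hM'
  set w : ℕ → ℝ := fun m => if m = 0 then A * δ⁻¹ ^ 3 else A * (m : ℝ)⁻¹ ^ 3 with hw
  have hmaps : ∀ i ∈ O, dep i ∈ Finset.range (M' + 1) := by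
    intro i hi
    have hiO : ¬ dist (y i) p ≤ ρ / 2 := (Finset.mem_filter.1 hi).2
    rw [Finset.mem_range, Nat.lt_add_one_iff]
    apply Nat.floor_le_floor
    linarith [not_le.1 hiO]
  have hfiber : ∀ m ∈ Finset.range (M' + 1),
      ∑ i ∈ O.filter (fun i => dep i = m), ∑ k ∈ T, max 0 (-lennardJones (dist (y i) (y k)))
        ≤ 48 * δ⁻¹ ^ 3 * (ρ + 1) ^ 2 * w m := by
    intro m hm
    have hmM : m ≤ M' := Nat.lt_add_one_iff.1 (Finset.mem_range.1 hm)
    have hmρ : (m : ℝ) ≤ ρ / 2 := le_trans (Nat.cast_le.2 hmM) (Nat.floor_le (by linarith))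
    have hsub : O.filter (fun i => dep i = m) ⊆
        Finset.univ.filter (fun i : Fin N => ρ - m - 1 < dist (y i) p ∧ dist (y i) p ≤ ρ - m) := by
      intro i hi
      rw [Finset.mem_filter] at hi
      obtain ⟨hiO, hmi⟩ := hi
      have hiW : dist (y i) p ≤ ρ := (hmW i).1 (Finset.mem_filter.1 hiO).1
      have ht0 : 0 ≤ ρ - dist (y i) p := by linarith
      have h1 : ((dep i : ℕ) : ℝ) ≤ ρ - dist (y i) p := Nat.floor_le ht0
      have h2 : ρ - dist (y i) p < (dep i : ℝ) + 1 := Nat.lt_floor_add_one _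
      rw [hmi] at h1 h2
      simp only [Finset.mem_filter, Finset.mem_univ, true_and]
      constructor <;> linarith
    have hsite : ∀ i ∈ O.filter (fun i => dep i = m), ∑ k ∈ T, max 0 (-lennardJones (dist (y i) (y k))) ≤ w m := by
      intro i hi
      have hiL := hsub hi
      simp only [Finset.mem_filter, Finset.mem_univ, true_and] at hiL
      have hiW : i ∈ W := (Finset.mem_filter.1 (Finset.mem_filter.1 hi).1).1
      by_cases hm0 : m = 0
      · subst hm0
        have hw0 : w 0 = A * δ⁻¹ ^ 3 := by rw [hw]; simp
        rw [hw0]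
        have h := site_negSkin y hδ hsep T (i := i) (hTi i hiW)
        have e : (1 / 6) * (250 * δ⁻¹ ^ 6) = A * δ⁻¹ ^ 3 := by rw [hA]; ring
        linarith
      · have hm1 : (1 : ℝ) ≤ m := by exact_mod_cast Nat.one_le_iff_ne_zero.2 hm0
        have hwm : w m = A * (m : ℝ)⁻¹ ^ 3 := by rw [hw]; simp [hm0]
        rw [hwm]
        have h := site_negTail y hδ hsep p ρ T hmT (r := (m : ℝ)) (hδ1.trans hm1) (i := i) hiL.2
        have e : (1 / 6) * (250 * δ⁻¹ ^ 3 * (m : ℝ)⁻¹ ^ 3) = A * (m : ℝ)⁻¹ ^ 3 := by rw [hA]; ring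
        linarith
    have hw0 : 0 ≤ w m := by
      rw [hw]
      simp only
      split_ifs <;> positivity
    have hLcard := layer_card y hδ hδ1 hsep p (ρ := ρ) (m := m) (by linarith)
    have hFcard : ((O.filter (fun i => dep i = m)).card : ℝ) ≤ 48 * δ⁻¹ ^ 3 * (ρ + 1) ^ 2 :=
      le_trans (by exact_mod_cast Finset.card_le_card hsub) hLcard
    have h1 := Finset.sum_le_sum hsite
    rw [Finset.sum_const, nsmul_eq_mul] at h1
    have h2 : ((O.filter (fun i => dep i = m)).card : ℝ) * w m ≤ 48 * δ⁻¹ ^ 3 * (ρ + 1) ^ 2 * w m :=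
      mul_le_mul_of_nonneg_right hFcard hw0
    linarith
  have hwsum : ∑ m ∈ Finset.range (M' + 1), w m ≤ A * δ⁻¹ ^ 3 + 2 * A := by
    rw [Finset.sum_range_succ']
    have h0 : w 0 = A * δ⁻¹ ^ 3 := by rw [hw]; simp
    have h1 : ∀ m ∈ Finset.range M', w (m + 1) = A * ((m : ℝ) + 1)⁻¹ ^ 3 := by
      intro m _
      rw [hw]
      simp only [Nat.add_one_ne_zero, if_false, Nat.cast_add, Nat.cast_one]
    rw [h0, Finset.sum_congr rfl h1, ← Finset.mul_sum]
    have h2 := sum_inv_cube_le M'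
    have h3 : A * ∑ m ∈ Finset.range M', ((m : ℝ) + 1)⁻¹ ^ 3 ≤ A * 2 := mul_le_mul_of_nonneg_left h2 hA0.le
    linarith
  have houter : ∑ i ∈ O, ∑ k ∈ T, max 0 (-lennardJones (dist (y i) (y k)))
      ≤ 48 * δ⁻¹ ^ 3 * (ρ + 1) ^ 2 * (A * δ⁻¹ ^ 3 + 2 * A) := by
    rw [← Finset.sum_fiberwise_of_maps_to hmaps (fun i => ∑ k ∈ T, max 0 (-lennardJones (dist (y i) (y k))))]
    have h1 := Finset.sum_le_sum hfiber
    have h2 : ∑ m ∈ Finset.range (M' + 1), 48 * δ⁻¹ ^ 3 * (ρ + 1) ^ 2 * w m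
        = 48 * δ⁻¹ ^ 3 * (ρ + 1) ^ 2 * ∑ m ∈ Finset.range (M' + 1), w m := by
      rw [Finset.mul_sum]
    rw [h2] at h1
    have h3 : 0 ≤ 48 * δ⁻¹ ^ 3 * (ρ + 1) ^ 2 := by positivity
    have h4 := mul_le_mul_of_nonneg_left hwsum h3
    linarith
  ------------------------------------------------------------------ conclusion
  have h48 : 48 * (ρ + 1) ^ 2 ≤ 60 * ρ ^ 2 := by
    nlinarith [mul_nonneg (by linarith : (0 : ℝ) ≤ ρ - 9) (by linarith : (0 : ℝ) ≤ ρ + 1)]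
  have hB0 : 0 ≤ A * δ⁻¹ ^ 3 + 2 * A := by positivity
  have hδ3 : 0 ≤ δ⁻¹ ^ 3 := by positivity
  have hρ2 : 1 ≤ ρ ^ 2 := by nlinarith
  have e1 : 64 * A * δ⁻¹ ^ 3 ≤ 64 * A * δ⁻¹ ^ 3 * ρ ^ 2 := le_mul_of_one_le_right (by positivity) hρ2
  have e2 : 48 * δ⁻¹ ^ 3 * (ρ + 1) ^ 2 * (A * δ⁻¹ ^ 3 + 2 * A) ≤ 60 * δ⁻¹ ^ 3 * (A * δ⁻¹ ^ 3 + 2 * A) * ρ ^ 2 := by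
    calc 48 * δ⁻¹ ^ 3 * (ρ + 1) ^ 2 * (A * δ⁻¹ ^ 3 + 2 * A)
        = (δ⁻¹ ^ 3 * (A * δ⁻¹ ^ 3 + 2 * A)) * (48 * (ρ + 1) ^ 2) := by ring
      _ ≤ (δ⁻¹ ^ 3 * (A * δ⁻¹ ^ 3 + 2 * A)) * (60 * ρ ^ 2) := mul_le_mul_of_nonneg_left h48 (mul_nonneg hδ3 hB0)
      _ = 60 * δ⁻¹ ^ 3 * (A * δ⁻¹ ^ 3 + 2 * A) * ρ ^ 2 := by ring
  have hDρ : D * ρ ^ 2 = 64 * A * δ⁻¹ ^ 3 * ρ ^ 2 + 60 * δ⁻¹ ^ 3 * (A * δ⁻¹ ^ 3 + 2 * A) * ρ ^ 2 := by rw [hD]; ring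
  linarith [hcore, houter]

/-! ## §3 The trial-state ceiling on ground-state windows -/

/-- **Trial-state ceiling on ground-state windows** (the CEIL support of the lens-1 node on `LooseTextureRung`): for every
`ε > 0` there is `ρ_ε` (here `max 9 (D/ε) (2N₀|e⋆|/ε)`) such that for all `ρ ≥ ρ_ε`, every window `B(p,ρ)` of a Lennard-Jones
ground state has `Σ_{B(p,ρ)} (𝓔ⁱ/2 − e⋆) ≤ ε·#B(p,ρ) + ε·ρ³`, `e⋆ = ⨅_Q e(Q)` — cut and paste (`stub_cutPasteLaw`) + the
trial bound `E(n) ≤ n(e(Q) + ε/2)` at a periodic `Q` with `e(Q) < e⋆ + ε/2` (re-derived in the proof from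
`BlancLewin2015_8_holds` + `le_energyPerParticle_of_tendsto`; small `n` by `groundStateEnergy_nonpos`) + `crossNeg_le`.
[cite: BlancLewin2015, §1.2 and §2.1] -/
theorem gsWindowCeiling : ∀ ε : ℝ, 0 < ε → ∃ ρc : ℝ, ∀ ρ : ℝ, ρc ≤ ρ →
    ∀ (N : ℕ) (y : Fin N → EuclideanSpace ℝ (Fin 3)), IsGroundState lennardJones y → ∀ p : EuclideanSpace ℝ (Fin 3),
      ∑ i ∈ Finset.univ.filter (fun i : Fin N => dist (y i) p ≤ ρ),
          (siteEnergy lennardJones y i / 2 - ⨅ Q : PeriodicConfiguration 3, Q.energyPerParticle lennardJones)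
        ≤ ε * ((Finset.univ.filter fun i : Fin N => dist (y i) p ≤ ρ).card : ℝ) + ε * ρ ^ 3 := by
  intro ε hε
  set eInf : ℝ := ⨅ Q : PeriodicConfiguration 3, Q.energyPerParticle lennardJones with heInf
  obtain ⟨D, hD⟩ := crossNeg_le
  have hlt : (⨅ Q : PeriodicConfiguration 3, Q.energyPerParticle lennardJones) < eInf + ε / 2 := by linarith
  obtain ⟨Q, hQ⟩ := exists_lt_of_ciInf_lt hlt
  -- the trial-state bound `E(n) ≤ n·(e(Q) + ε/2)` for `n ≥ N₀` (= tree `ExcessDecayLiouvilleCoarseGrains.stub_trialBound`)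
  obtain ⟨N₀, hN₀⟩ : ∃ N₀ : ℕ, ∀ n : ℕ, N₀ ≤ n →
      groundStateEnergy lennardJones 3 n ≤ (n : ℝ) * (Q.energyPerParticle lennardJones + ε / 2) := by
    obtain ⟨e, -, htend, -⟩ := BlancLewin2015_8_holds 3 (by norm_num) (by norm_num)
    have heQ : e ≤ Q.energyPerParticle lennardJones := le_energyPerParticle_of_tendsto htend Q
    have hev : ∀ᶠ n : ℕ in atTop, groundStateEnergy lennardJones 3 n / n < e + ε / 2 :=
      htend.eventually (gt_mem_nhds (by linarith))
    obtain ⟨N₀, hN₀⟩ := eventually_atTop.1 hev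
    refine ⟨N₀ + 1, fun n hn => ?_⟩
    have hnpos : (0 : ℝ) < n := by exact_mod_cast (show 0 < n by omega)
    have h := hN₀ n (by omega)
    rw [div_lt_iff₀ hnpos] at h
    have h2 : (e + ε / 2) * n ≤ (n : ℝ) * (Q.energyPerParticle lennardJones + ε / 2) := by
      rw [mul_comm]
      exact mul_le_mul_of_nonneg_left (by linarith) hnpos.le
    exact h.le.trans h2
  refine ⟨max 9 (max (D / ε) (2 * ((N₀ : ℝ) * |eInf|) / ε)), fun ρ hρ N y hy p => ?_⟩
  have h9 : 9 ≤ ρ := le_trans (le_max_left _ _) hρ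
  have hρD : D / ε ≤ ρ := le_trans (le_trans (le_max_left _ _) (le_max_right _ _)) hρ
  have hρN : 2 * ((N₀ : ℝ) * |eInf|) / ε ≤ ρ := le_trans (le_trans (le_max_right _ _) (le_max_right _ _)) hρ
  have hDε : D * ρ ^ 2 ≤ ε * ρ ^ 3 := by
    have h1 : D ≤ ρ * ε := (div_le_iff₀ hε).mp hρD
    have hρ2 : (0 : ℝ) ≤ ρ ^ 2 := by positivity
    calc D * ρ ^ 2 ≤ (ρ * ε) * ρ ^ 2 := mul_le_mul_of_nonneg_right h1 hρ2
      _ = ε * ρ ^ 3 := by ring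
  have hNε : (N₀ : ℝ) * |eInf| ≤ ε / 2 * ρ ^ 3 := by
    have h1 : 2 * ((N₀ : ℝ) * |eInf|) ≤ ρ * ε := (div_le_iff₀ hε).mp hρN
    have hρsq : (1 : ℝ) ≤ ρ ^ 2 := by nlinarith
    have hρ3 : ρ ≤ ρ ^ 3 :=
      calc ρ = ρ * 1 := (mul_one ρ).symm
        _ ≤ ρ * ρ ^ 2 := mul_le_mul_of_nonneg_left hρsq (by linarith)
        _ = ρ ^ 3 := by ring
    have h2 : ρ * ε ≤ ρ ^ 3 * ε := mul_le_mul_of_nonneg_right hρ3 hε.le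
    linarith
  have hcp := CrystalliteDichotomyCutPasteLaw.stub_cutPasteLaw N y hy (Finset.univ.filter fun i : Fin N => dist (y i) p ≤ ρ)
  have hneg := hD ρ h9 N y hy p
  set W := Finset.univ.filter (fun i : Fin N => dist (y i) p ≤ ρ) with hW
  have hsite : ∑ i ∈ W, siteEnergy lennardJones y i = ∑ a ∈ W, ∑ b ∈ Finset.univ.erase a, lennardJones (dist (y a) (y b)) := rfl
  have hE0 := groundStateEnergy_nonpos W.card
  have hEW : groundStateEnergy lennardJones 3 W.card - (W.card : ℝ) * eInf ≤ ε * (W.card : ℝ) + (N₀ : ℝ) * |eInf| := by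
    by_cases hWN : N₀ ≤ W.card
    · have h1 := hN₀ W.card hWN
      have hc0 : (0 : ℝ) ≤ (W.card : ℝ) := by positivity
      have h2 : (W.card : ℝ) * (Q.energyPerParticle lennardJones + ε / 2) ≤ (W.card : ℝ) * (eInf + ε) :=
        mul_le_mul_of_nonneg_left (by linarith) hc0
      have h3 : (0 : ℝ) ≤ (N₀ : ℝ) * |eInf| := by positivity
      linarith
    · rw [not_le] at hWN
      have h1 : (W.card : ℝ) ≤ N₀ := by exact_mod_cast hWN.le
      have h2 : -((W.card : ℝ) * eInf) ≤ (W.card : ℝ) * |eInf| := by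
        rw [← mul_neg]
        exact mul_le_mul_of_nonneg_left (neg_le_abs _) (by positivity)
      have h3 : (W.card : ℝ) * |eInf| ≤ (N₀ : ℝ) * |eInf| := mul_le_mul_of_nonneg_right h1 (abs_nonneg _)
      have h4 : (0 : ℝ) ≤ ε * (W.card : ℝ) := by positivity
      linarith
  have hsum : ∑ i ∈ W, (siteEnergy lennardJones y i / 2 - eInf)
      = (∑ i ∈ W, siteEnergy lennardJones y i) / 2 - (W.card : ℝ) * eInf := by
    rw [Finset.sum_sub_distrib, Finset.sum_const, nsmul_eq_mul, ← Finset.sum_div]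
  rw [hsum, hsite]
  linarith [hcp, hneg, hEW, hDε, hNε]

end Summit.AtomisticToContinuum.Crystallization.Theorems.ContactSaturationLadderWindowCeiling

end
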